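import Literature.MathematicalPhysics.QuantumFieldTheory.Balaban1983to89.B4Prop23ZeroBox

/-!
# `Balaban1983to89.B4Lemma24ZeroBoxScale` — B4 Lemma 2.4 (2.35)–(2.37) AS TYPED (`B4.Lemma24Printed`): the first
concrete carrier family of `B4.ScaleSetting` — the zero-field Neumann boxes at every scale — with the typed leaf's
FIRST CONJUNCT ((2.35) both quantities, (2.37); one pair `c₀, δ₀`) and its SECOND CONJUNCT FOR `0 ≤ α < 1` ((2.36), the
same `δ₀`, a constant `c₁(α)`) discharged HYPOTHESIS-FREE from the displays of `B4Green242Bridge`, `B4Green244`,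
`B4StripSumsHolder` and `B4BoxCov237` (a sibling of `B4Prop23ZeroBox`; no existing module is touched; nothing of B4 is
asserted)

Source under audit (cell pub-balaban): T. Bałaban, *Regularity and decay of lattice Green's functions*, Commun. Math.
Phys. **89** (1983) 571–597 [`Balaban1983RegularityDecay`, "B4"], p. 582 [PDF 12] (2.34) and Lemma 2.4 (2.35)–(2.37),
p. 584 [PDF 14] (proof of Lemma 2.4, first two paragraphs, (2.42), (2.44)), p. 573 [PDF 3] (the difference derivative;
(1.13)–(1.14)) (journal page = PDF page + 570; renders
`b2b-balaban-ref1/pages/1983-cmp89-regularity-decay/1983-cmp89-regularity-decay-p012-x2.png`, `-p014-x2.png`,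
`-p003-x2.png`, read as images).

## WHAT IS PRINTED (verbatim; `≦` of the print written `≤`)

p. 582: «corresponding properties for the propagator G_k(□, 0), or to the one-component propagator G_k(□)
[G_k(□, 0) = G_k(□)1, 1 is identity operator on R^N]. This proof is based on renormalization group equations (2.43)
of [1] rescaled to the η-lattice:
G_k(□) = C^{(0),η}(□) + Σ_{j=1}^{k−1} a_j²(L^jη)^{−4}G_j^η(□)Q_j^*C^{(j),L^jη}(□)Q_jG_j^η(□).   (2.34)
The expressions on the right hand side above are built with the help of the operators G_j^η(□)Q_j^*, C^{(j),L^jη}(□)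
and we need some of their basic properties. They are gathered in the following
Lemma 2.4. There exist positive constants c₀, δ₀, and for α<1, there exists a constant c₁, such that
|(G_j(□)Q_j^*)(x, y)|, |(∂_μ^{L^{−j}} G_j(□)Q_j^*)(x, y)| ≤ c₀e^{−δ₀|x−y|},   (2.35)
(1/|x−x′|^α) |(∂_μ^{L^{−j}} G_j(□)Q_j^*)(x, y) − (∂_μ^{L^{−j}} G_j(□)Q_j^*)(x′, y)| ≤ c₁e^{−δ₀ dist({x,x′},y)},   (2.36)
|C^{(j)}(□; y, y′)| ≤ c₀e^{−δ₀|y−y′|},   (2.37)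
for arbitrary non-negative integer j, arbitrary, rectangular parallelepiped □ ⊂ L^{−j}Z^d built of large blocks, and
x, x′ ∈ □, y, y′ ∈ □^{(j)} = □∩Z^d.»

p. 584: «Proof of Lemma 2.4. At first let us notice that the inequality (2.37) concerning C^{(j)}(□) is a special case
of Proposition 2.3. The proof of this proposition will be given in the next section and is based on Corollary 2.3
only. Thus we can assume that (2.37) is proved.
The proof of (2.35), (2.36) can be reduced again to a simpler case. This part of the argument is valid for an
arbitrary rectangular parallelepiped □ built of unit blocks, so the inequalities are valid for all such sets. Let us
denote ξ = L^{−j}. We represent G_j(□) with the help of the propagator G_j with free boundary conditions on ξZ^d using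
the multiple reflection method. If □ is written as □ = {x∈ξZ^d : 0 ≤ x_μ ≤ M_μ, μ = 1,…,d}, then
G_j(□; x, x′) = G_j(x, x′) + Σ_{μ=1}^d G_j(x, (x′_1,…,−x′_μ−ξ,…,x′_d)) + Σ_{μ=1}^d G_j(x, (x′_1,…,2M_μ−ξ−x′_μ,…,x′_d))
+ … .   (2.42)
Using this representation it is enough to prove (2.35), (2.36) for the propagator G_j.» … «We apply it to the basic
equation (−Δ^ξ + m_j² + a_jQ_j^*Q_j)φ₀ = f.   (2.44)  Defining the propagator G_j, φ₀ = G_jf, we get …».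

p. 573: «[Of course ∂^η_μ is a difference derivative defined by (∂^η_μ A)(x) = η^{−1}(A(x+ηe_μ) − A(x)).]» …
«C_Λ^{(k)}(Ω, A) = ((Δ^{(k)}(Ω, A) + aL^{−2}P(A))|_Λ)^{−1}.   (1.13)  Here Δ^{(k)}(Ω, A) is an operator of the effective
Gaussian action after k renormalization transformations and can be defined by
Δ^{(k)}(Ω, A) = a_kI − a_k²Q_k(A)G_k(Ω, A)Q_k^*(A),   (1.14)  where a_k is a constant proportional to a.»

p. 586 (end of the proof, quoted in `B4Green242Bridge`): «≤ O(1), the constant depends on α<1.   (2.51)» … «we can bound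
the left hand side of (2.49) by a constant depending on α multiplied by the exponential factor e^{−δ₀|x′−y|} =
e^{−δ₀dist({x,x′},y)}. We get the inequality (2.36). The inequalities (2.35) are proved in the same way and constants
depend on d only.»

## THE TYPED LEAF (tree, `B4.lean`, surge node T01.2; verbatim)

`B4.Lemma24Printed (fam : I → B4.ScaleSetting) : Prop := ∃ c₀ δ₀ : ℝ, 0 < c₀ ∧ 0 < δ₀ ∧ (∀ i : I, (fam i).rectLarge →
(∀ x y, (fam i).kerGQ x y ≤ c₀ * Real.exp (-(δ₀ * (fam i).distF x y))) ∧ (∀ μ x y, (fam i).kerDGQ μ x y ≤ c₀ * Real.exp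
(-(δ₀ * (fam i).distF x y))) ∧ (∀ y y', (fam i).kerC y y' ≤ c₀ * Real.exp (-(δ₀ * (fam i).distU y y')))) ∧ (∀ α : ℝ,
α < 1 → ∃ c₁ : ℝ, 0 < c₁ ∧ ∀ i : I, (fam i).rectLarge → ∀ μ x x' y, (fam i).lhs236 α μ x x' y ≤ c₁ * Real.exp (-(δ₀ *
(fam i).dist2F x x' y)))` over the ABSTRACT carrier `B4.ScaleSetting` (fields `SiteF SiteU Dir rectLarge distF dist2F
distU kerGQ kerDGQ lhs236 kerC`).  Before this file no concrete family `I → B4.ScaleSetting` existed in the tree; the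
consumers (`B5FromB4.prop12_of_B4`, `B5Prop12Chain`, `B5Ineq110Gp.leafGp_of_lemma24` with its dictionary `Dict24Gp`)
take `h24 : B4.Lemma24Printed fam₂₄` as a hypothesis, and `leafGp_of_lemma24` uses its FIRST conjunct only.

## WHAT THIS FILE CERTIFIES (kernel-checked, zero `sorry`; the cited displays are USED, not re-proved)

* §2 `ScaleIdx d ℓ a₋ a₊ m²₊ a₂₋ a₂₊` indexes every zero-field box instance of Lemma 2.4 in dimension `d + 1` with block
  size `L = ℓ + 1`: a mesh `n ≥ 1` (`ξ = 1/n`; the print's `n = L^j`, and every other `n ≥ 1` as well), constants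
  `a_j ∈ [a₋, a₊]`, `m_j² ∈ [0, m²₊]` of `G_j(□)` ((2.44)) and `a ∈ [a₂₋, a₂₊]` of `C^{(j)}(□)` ((1.13)), and a box `□`
  whose unit trace `□^{(j)}` has side lengths `M_μ = L·M′_μ`, `M′_μ ≥ 1` («built of large blocks»);
  `zeroFieldScales … : ScaleIdx … → B4.ScaleSetting` fills the abstract carrier with the package's `A = 0` objects (see
  the DICTIONARY and the docstring of `zeroFieldScales`).
* §3 `bounds235and237_zeroFieldScales`: THE FIRST CONJUNCT of `B4.Lemma24Printed (zeroFieldScales d ℓ …)` — one pair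
  `c₀, δ₀ > 0` (depending on `d, ℓ` and the window only) with (2.35) for `|(G_j(□)Q_j^*)(x,y)|` and for
  `|(∂^ξ_μG_j(□)Q_j^*)(x,y)|` and (2.37) for `|C^{(j)}(□; y,y′)|`, for EVERY member — from
  `B4Green242Bridge.greenBoxQ_decay_235_inv`, `B4Green242Bridge.greenBoxQ_deriv_decay_235_inv` (b04/pv17: (2.35) both
  quantities for the constructed box propagator, decay in the block label `|blk x − y|_∞`) and
  `B4BoxCov237.cov237_box_decay` ((2.37)), transported to the point distance `|ξx − y|_∞ ≤ |blk x − y|_∞ + 1` (§1) and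
  merged by `min`/`max` (`B4Prop23ZeroBox.exp_bound_weaken`).  `Bounds235and237`/`Bound236` name the two halves of the
  leaf and `lemma24Printed_iff : B4.Lemma24Printed fam ↔ ∃ c₀ δ₀, … ∧ Bounds235and237 fam c₀ δ₀ ∧ ∀ α < 1, Bound236 fam δ₀ α`
  is `Iff.rfl`.
* §4 the Hölder kernel bounds RE-THREADED WITH THE RATE CHOSEN BEFORE `α` (the print's quantifier order «c₀, δ₀, and for
  α<1 … c₁»; p. 586 «the constant depends on α<1» — the constant, not the rate): `hkernel248_decay_unif` (b04's
  `B4StripSumsHolder.holder248_stripRegular`, whose strip half-width `min κ₁ (rOf (d+1))`, `κ₁` from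
  `B4StripCauchy.uniformStrip_holds`, does not depend on `α`, followed by `B4ContourShift.latticeKernel_decay`),
  `K_holder_decay_unif` (b04's `B4Green242Bridge.K_holder_decay`, proof text verbatim) and `holder236_param` (b04's
  `B4Green242Bridge.greenBoxQ_holder_decay_236` with its three kernel packages — `K_decay`, the Hölder kernel bound,
  `greenBoxQ_deriv_decay_235` — turned into hypotheses, proof text verbatim, so that the output rate
  `min (κ₀/(d+1)) κ₃` is an explicit function of the input rates).  The tree's `hkernel248_decay`, `K_holder_decay`,
  `greenBoxQ_holder_decay_236(_inv)` state `∀ α, ∃ κ C, …`; nothing in them is changed or re-proved differently — the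
  SAME proofs are run with the `obtain` of the `α`-independent strip moved in front of `α`.
* §5 `bound236_zeroFieldScales`: ONE rate `δ₁ > 0` such that for every `0 ≤ α < 1` there is `c₁ > 0` with (2.36) for
  every member; `Lemma24PrintedNN` := `B4.Lemma24Printed` with `0 ≤ α →` inserted (nothing else changed),
  `lemma24PrintedNN_of_printed : B4.Lemma24Printed fam → Lemma24PrintedNN fam` for any family, and
  **`lemma24PrintedNN_zeroFieldScales : Lemma24PrintedNN (zeroFieldScales d ℓ a₋ a₊ m²₊ a₂₋ a₂₊)`** for every `d`,
  every `ℓ ≥ 1` and every window with `a₋ > 0`, `a₂₋ > 0` (`δ₀ := min` of the two rates).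
* §6 non-vacuity: the index type of the physical window `d + 1 = 4`, `L = 2`, `[1/2, 2] × [0, 1] × [1/2, 2]` is
  inhabited (`idx0`: `n = 2`, the box `[0, 2)^4` of one `L`-block), `rectLarge` is `True`, and the member's site and
  direction types are nonempty, so the certified statements are not vacuous.

## DICTIONARY (print ↦ Lean, all at `A = 0`, one component)

`j ≥ 0`, `ξ = L^{−j}` ↦ the mesh `i.n` (`= L^j` fine points per unit length; `ξx ↦ x : Fin (d+1) → ℤ` integer fine
coordinates); `L` ↦ `ℓ + 1`; `□ ⊂ ξZ^d` (rectangular parallelepiped built of large blocks) ↦ the fine box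
`B4Reflection242.boxDom (fun μ => i.n * i.M μ)` = `Π_μ [0, n·M_μ)`, `M_μ = (ℓ+1)·M′_μ` (`ScaleIdx.M`), with NEUMANN
boundary conditions (the sum over bonds inside `□`, (1.3) with `Ω = □`); `□^{(j)} = □ ∩ Z^d` ↦ `boxDom i.M`; the block
of a fine point ↦ `B4Reflection242.blk n x = ⌊x/n⌋` (coordinatewise); `−Δ^ξ + m_j² + a_jQ_j^*Q_j` on `□` ((2.44) with
Neumann b.c., in lattice units `n²(−Δ^N_□) + m² + a·n^{−(d+1)}𝟙[same block]`) ↦ `B4Green242Bridge.boxOp i.n i.a₁ i.m2 i.M`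
and `G_j(□)` ↦ `(boxOp …)⁻¹` (`Matrix.inv`; it IS the inverse: `B4Green242Bridge.boxOp_mul_inv`); `(G_j(□)Q_j^*)(x, y)` ↦
`Σ_{x′ ∈ □, blk x′ = y} (boxOp …)⁻¹ x x′` (unit-lattice convention for `Q_j^*`: unweighted block sum, as in
`B4Green242Bridge`/`B4Reflection242` §9 and XREAD C-pv13g4-4 (b)); `∂^ξ_μ` ↦ the forward difference quotient
`n·(F(x + e_μ) − F(x))` (p. 573); `|x − y|` (x fine, y unit) ↦ `fdist n x y = |x − n·y|_∞/n = |ξx − y|_∞`;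
`dist({x,x′}, y)` ↦ `min (fdist n x y) (fdist n x′ y)`; `|y − y′|` ↦ `supNorm (y − y′)`; `1/|x − x′|^α` ↦
`(n/|x′ − x|_∞)^α` (`Real.rpow`); `C^{(j)}(□)` = `((Δ^{(j)}(□) + aL^{−2}P)|_{□^{(j)}})^{−1}` ((1.13)–(1.14), `Λ = □^{(j)}`) ↦
`(B4BoxCov237.covOp i.n ℓ i.a₁ i.a₂ i.m2 i.M′)⁻¹` (it IS the inverse: first conjunct of `cov237_box_decay`); «□ built of
large blocks» ↦ `rectLarge := True` (structural: every member is such a box); directions `μ` ↦ `Fin (d + 1)`.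

## HONEST SCOPE

(a) Gauge field `A = 0`, one component (p. 582: «G_k(□, 0) = G_k(□)1»): the objects of Lemma 2.4 are zero-field objects
by nature (they are the building blocks of (2.34) for `G_k(□) = G_k(□, 0)`); nothing is claimed for `A ≠ 0`.
(b) Norms: `|·|` of the print (Euclidean) is read as the sup norm throughout (fine–unit distance `|ξx − y|_∞`,
`dist_∞({ξx, ξx′}, y)`, `|y − y′|_∞`, and the Hölder weight `|ξx − ξx′|_∞^{−α}`); the two readings are equivalent up to
factors `√(d+1)` in `δ₀` and `(d+1)^{α/2}` in `c₁` — recorded, not certified here.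
(c) Conventions at the boundary of the carrier (the typist's, forced by totality of the fields): `kerDGQ μ x y := 0`
when the forward neighbour `x + e_μ` is not in `□` (the Neumann box propagator lives on `□`; the print writes `x ∈ □`
without comment), and `lhs236 α μ x x′ y := 0` when either forward neighbour leaves `□` or `x = x′` (the print's
quotient `1/|x − x′|^α` is not defined at `x = x′`).  On these arguments the certified inequalities hold trivially; on
all others they are the printed ones.
(d) Meshes: the family contains every `n ≥ 1`, not only `n = L^j`; each member is a legitimate instance and the
constants are uniform over all of them (a fortiori over `n = L^j`).  Boxes: every box whose unit trace has sides
`L·M′_μ`, `M′_μ ≥ 1`, anchored at the origin (translation is a relabelling).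
(e) THE EXPONENT `α`.  The typed leaf quantifies `∀ α : ℝ, α < 1` literally.  This file certifies the clause for
`0 ≤ α < 1` (`Lemma24PrintedNN`), which is the range in which (2.36) is a Hölder estimate and the range supplied by the
audited momentum-space bound (`B4StripSumsHolder`, `0 ≤ α < 1`).  For `α < 0` the typed weight `(n/|x′−x|_∞)^α =
|ξx − ξx′|_∞^{|α|}` is unbounded over boxes of unbounded size while the right-hand side `c₁e^{−δ₀dist({x,x′},y)}` is
bounded, so the clause with `α < 0` is NOT claimed for this family (nor refuted here); whether the typed leaf should
read `0 ≤ α < 1` (or `0 < α < 1`) is a question for the owner of `B4.lean`, recorded in the cell's GAPS/DIVERGENCE files.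
Consequently this file proves `Lemma24PrintedNN (zeroFieldScales …)` and the FIRST CONJUNCT of
`B4.Lemma24Printed (zeroFieldScales …)` (`bounds235and237_zeroFieldScales`, all that `B5Ineq110Gp.leafGp_of_lemma24`
consumes), not `B4.Lemma24Printed (zeroFieldScales …)` itself.
(f) Value: a kernel certificate that the typed leaf's content (in the range (e)) holds for the package's own zero-field
objects, assembled from displays already in the tree; it is NOT a new reading of the print and NOT progress on any
summit statement.  The `j`-uniform complex strip of p. 586 («more troublesome, but equally elementary») is the one
PROVED in `B4StripCauchy.uniformStrip_holds` (b04), used here through `hkernel248_decay_unif`.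

## PROVENANCE

§1–§3, §5–§6: this node (pv17).  §4: the proof texts of `K_holder_decay_unif` and `holder236_param` are b04's
(`B4Green242Bridge.K_holder_decay`, `greenBoxQ_holder_decay_236`), copied verbatim below their first `obtain`s with
the rate threaded as described; `hkernel248_decay_unif` is b04's `holder248_stripRegular` + `latticeKernel_decay` with
the `obtain` of `uniformStrip_holds` moved in front of `α`.  Axioms: `propext`, `Classical.choice`, `Quot.sound` only.
-/

namespace Literature.MathematicalPhysics.QuantumFieldTheory.Balaban1983to89.B4Lemma24ZeroBoxScale

open Finset Matrix
open Literature.MathematicalPhysics.QuantumFieldTheory.Balaban1983to89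
open Literature.MathematicalPhysics.QuantumFieldTheory.Balaban1983to89.B4ContourShift
open Literature.MathematicalPhysics.QuantumFieldTheory.Balaban1983to89.B4Reflection242
open Literature.MathematicalPhysics.QuantumFieldTheory.Balaban1983to89.B4Green242Bridge
open Literature.MathematicalPhysics.QuantumFieldTheory.Balaban1983to89.B4BoxCov237
open Literature.MathematicalPhysics.QuantumFieldTheory.Balaban1983to89.B4Prop23ZeroBox

variable {d : ℕ}

noncomputable section

/-! ## §1  The distance `|ξx − y|_∞` between a fine point and a unit point, and the transport of block-label decay -/

/-- `|ξx − y|_∞` for a fine site `x ∈ ℤ^{d+1}` (spacing `ξ = 1/n`) and a unit site `y ∈ ℤ^{d+1}`: the sup norm of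
`ξx − y = ξ(x − n·y)`. [folklore] -/
def fdist (n : ℕ) (x y : Fin (d + 1) → ℤ) : ℝ := supNorm (x - fun i => (n : ℤ) * y i) / n

/-- `|ξx − y|_∞ ≥ 0`. [folklore] -/
theorem fdist_nonneg (n : ℕ) (x y : Fin (d + 1) → ℤ) : 0 ≤ fdist n x y :=
  div_nonneg (supNorm_nonneg _) (Nat.cast_nonneg n)

/-- `|x − n·y|_∞ ≤ n·(|blk x − y|_∞ + 1)`: a fine point lies in its unit block. [folklore] -/
theorem supNorm_sub_mul_le {n : ℕ} (hn : 1 ≤ n) (x y : Fin (d + 1) → ℤ) :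
    supNorm (x - fun i => (n : ℤ) * y i) ≤ (n : ℝ) * (supNorm (blk n x - y) + 1) := by
  apply supNorm_le_of_forall
  intro i
  have hn0 : (0 : ℤ) < n := by exact_mod_cast hn
  have h1 : x i % n = x i - n * (x i / n) := Int.emod_def (x i) n
  have h2 : 0 ≤ x i % n := Int.emod_nonneg _ hn0.ne'
  have h3 : x i % n < n := Int.emod_lt_of_pos _ hn0
  have hS : ((|x i / n - y i| : ℤ) : ℝ) ≤ supNorm (blk n x - y) := by
    have := abs_le_supNorm (blk n x - y) i
    simpa [blk] using this
  have key : (|x i - n * y i| : ℤ) ≤ n * |x i / n - y i| + n := by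
    have e : x i - n * y i = n * (x i / n - y i) + x i % n := by rw [mul_sub, h1]; ring
    rw [e]
    calc |(n : ℤ) * (x i / n - y i) + x i % n| ≤ |(n : ℤ) * (x i / n - y i)| + |x i % n| := abs_add_le _ _
      _ = n * |x i / n - y i| + x i % n := by rw [abs_mul, abs_of_pos hn0, abs_of_nonneg h2]
      _ ≤ n * |x i / n - y i| + n := by linarith
  have keyR : ((|x i - n * y i| : ℤ) : ℝ) ≤ (n : ℝ) * ((|x i / n - y i| : ℤ) : ℝ) + n := by exact_mod_cast key
  have hn' : (0 : ℝ) ≤ n := Nat.cast_nonneg n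
  simp only [Pi.sub_apply]
  nlinarith [hS, keyR, hn', mul_le_mul_of_nonneg_left hS hn']

/-- `|ξx − y|_∞ ≤ |blk x − y|_∞ + 1`. [folklore] -/
theorem fdist_le_blk {n : ℕ} (hn : 1 ≤ n) (x y : Fin (d + 1) → ℤ) : fdist n x y ≤ supNorm (blk n x - y) + 1 := by
  have hn0 : (0 : ℝ) < n := by exact_mod_cast hn
  unfold fdist
  rw [div_le_iff₀ hn0, mul_comm]
  exact supNorm_sub_mul_le hn x y

/-- transport of a decay bound from the block label to the point: `C e^{−κS} ≤ (C e^{κ}) e^{−κD}` when `D ≤ S + 1`.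
[folklore] -/
theorem exp_transport {C κ S D : ℝ} (hC : 0 ≤ C) (hκ : 0 ≤ κ) (hSD : D ≤ S + 1) :
    C * Real.exp (-(κ * S)) ≤ C * Real.exp κ * Real.exp (-(κ * D)) := by
  rw [mul_assoc, ← Real.exp_add]
  apply mul_le_mul_of_nonneg_left _ hC
  apply Real.exp_le_exp.mpr
  nlinarith [mul_le_mul_of_nonneg_left hSD hκ]

/-! ## §2  The zero-field box carriers of `B4.ScaleSetting` -/

/-- **INDEX OF THE ZERO-FIELD BOX INSTANCES** of Lemma 2.4 in dimension `d + 1`, block size `L = ℓ + 1`, over the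
window `a_j ∈ [a₋, a₊]`, `m_j² ∈ [0, m²₊]`, `a ∈ [a₂₋, a₂₊]`: a mesh `n ≥ 1` (`n = L^j` fine points per unit length,
`ξ = 1/n`), the constants `a₁ = a_j`, `m2 = m_j²` of `G_j(□)` ((2.44)) and `a₂ = a` of `aL^{-2}P` in `C^{(j)}(□)` ((1.13)),
and the box `□` of unit side lengths `L·M′_μ` (`M′_μ ≥ 1`), i.e. built of `L`-blocks. [folklore] -/
structure ScaleIdx (d ℓ : ℕ) (aminus aplus m2plus a2minus a2plus : ℝ) where
  n : ℕ
  hn : 1 ≤ n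
  a₁ : ℝ
  m2 : ℝ
  a₂ : ℝ
  ha₁ : aminus ≤ a₁
  ha₁' : a₁ ≤ aplus
  hm : 0 ≤ m2
  hm' : m2 ≤ m2plus
  ha₂ : a2minus ≤ a₂
  ha₂' : a₂ ≤ a2plus
  M' : Fin (d + 1) → ℕ
  hM : ∀ i, 1 ≤ M' i

/-- the unit side lengths `M_μ = L·M′_μ` of the box. [folklore] -/
abbrev ScaleIdx.M {d ℓ : ℕ} {aminus aplus m2plus a2minus a2plus : ℝ}
    (i : ScaleIdx d ℓ aminus aplus m2plus a2minus a2plus) : Fin (d + 1) → ℕ := fun j => (ℓ + 1) * i.M' j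

/-- the box has at least one unit block in every direction: `M_μ = L·M′_μ ≥ 1`. [folklore] -/
theorem ScaleIdx.one_le_M {d ℓ : ℕ} {aminus aplus m2plus a2minus a2plus : ℝ}
    (i : ScaleIdx d ℓ aminus aplus m2plus a2minus a2plus) (j : Fin (d + 1)) : 1 ≤ i.M j := by
  show 1 ≤ (ℓ + 1) * i.M' j
  nlinarith [i.hM j]

/-- **THE ZERO-FIELD BOX CARRIERS OF `B4.ScaleSetting`** (see the module docstring, DICTIONARY): for the instance `i`
(mesh `n`, constants `a_j, m_j², a`, box of unit sides `M = L·M′`), `SiteF = □ = Π_μ [0, n·M_μ)` (fine sites, integer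
coordinates, spacing `ξ = 1/n`), `SiteU = □^{(j)} = Π_μ [0, M_μ)`, `Dir = Fin (d+1)`, `rectLarge = True` (every member IS
a rectangular parallelepiped built of `L`-blocks), `distF x y = |ξx − y|_∞`, `dist2F x x′ y = min (|ξx − y|_∞) (|ξx′ − y|_∞)`
(= dist({x,x′},y)), `distU y y′ = |y − y′|_∞`; `kerGQ x y = |(G_j(□)Q_j^*)(x,y)| = |Σ_{x′ ∈ □, blk x′ = y} G_j(□; x, x′)|`
with `G_j(□) = (boxOp n a_j m_j² M)⁻¹` the Neumann box propagator of (2.44) (`B4Green242Bridge.boxOp`, lattice units);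
`kerDGQ μ x y = |(∂^ξ_μ G_j(□)Q_j^*)(x,y)| = |n·Σ_{blk x′ = y}(G_j(□; x+e_μ, x′) − G_j(□; x, x′))|` when the forward
neighbour `x + e_μ` lies in `□`, and `0` otherwise; `lhs236 α μ x x′ y = (n/|x′−x|_∞)^α·|(∂^ξ_μ G_j(□)Q_j^*)(x′,y) −
(∂^ξ_μ G_j(□)Q_j^*)(x,y)|` (`(n/|x′−x|_∞)^α = 1/|ξx − ξx′|_∞^α`) when both forward neighbours lie in `□` and `x′ ≠ x`,
and `0` otherwise; `kerC y y′ = |C^{(j)}(□; y, y′)| = |(covOp n ℓ a_j a m_j² M′)⁻¹ y y′|` (`B4BoxCov237.covOp` =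
`Δ^{(j)}(□) + aL^{−2}P` of (1.13)–(1.14) at `A = 0`).
[cite: Balaban1983RegularityDecay, p. 582 Lemma 2.4 (2.35)–(2.37), p. 584 (2.42)/(2.44), p. 573 (1.13)–(1.14) and the
difference derivative; dictionary] -/
def zeroFieldScales (d ℓ : ℕ) (aminus aplus m2plus a2minus a2plus : ℝ)
    (i : ScaleIdx d ℓ aminus aplus m2plus a2minus a2plus) : B4.ScaleSetting where
  SiteF := ↥(boxDom (fun j => i.n * i.M j))
  SiteU := ↥(boxDom i.M)
  Dir := Fin (d + 1)
  rectLarge := True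
  distF := fun x y => fdist i.n x.1 y.1
  dist2F := fun x x' y => min (fdist i.n x.1 y.1) (fdist i.n x'.1 y.1)
  distU := fun y y' => supNorm (y.1 - y'.1)
  kerGQ := fun x y => ‖∑ x' : ↥(boxDom (fun j => i.n * i.M j)),
      (if blk i.n x'.1 = y.1 then (boxOp i.n i.a₁ i.m2 i.M)⁻¹ x x' else 0)‖
  kerDGQ := fun μ x y =>
    if h : x.1 + Pi.single μ 1 ∈ boxDom (fun j => i.n * i.M j) then
      ‖(i.n : ℂ) * ∑ x' : ↥(boxDom (fun j => i.n * i.M j)),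
        (if blk i.n x'.1 = y.1 then
          (boxOp i.n i.a₁ i.m2 i.M)⁻¹ ⟨x.1 + Pi.single μ 1, h⟩ x' - (boxOp i.n i.a₁ i.m2 i.M)⁻¹ x x' else 0)‖
    else 0
  lhs236 := fun α μ x x' y =>
    if h : x.1 + Pi.single μ 1 ∈ boxDom (fun j => i.n * i.M j) ∧
        x'.1 + Pi.single μ 1 ∈ boxDom (fun j => i.n * i.M j) ∧ x'.1 ≠ x.1 then
      ((i.n : ℝ) / supNorm (x'.1 - x.1)) ^ α *
        ‖(i.n : ℂ) * ∑ x'' : ↥(boxDom (fun j => i.n * i.M j)),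
          (if blk i.n x''.1 = y.1 then
            ((boxOp i.n i.a₁ i.m2 i.M)⁻¹ ⟨x'.1 + Pi.single μ 1, h.2.1⟩ x'' - (boxOp i.n i.a₁ i.m2 i.M)⁻¹ x' x'')
              - ((boxOp i.n i.a₁ i.m2 i.M)⁻¹ ⟨x.1 + Pi.single μ 1, h.1⟩ x'' - (boxOp i.n i.a₁ i.m2 i.M)⁻¹ x x'')
          else 0)‖
    else 0
  kerC := fun y y' => |(covOp i.n ℓ i.a₁ i.a₂ i.m2 i.M')⁻¹ y y'|

/-! ## §3  The two halves of the typed leaf, and the first half for the zero-field box carriers -/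

/-- the first half of `B4.Lemma24Printed` at constants `c₀, δ₀`: (2.35) both quantities and (2.37) — literally the
first conjunct of the typed leaf (`lemma24Printed_iff` is `Iff.rfl`).
[cite: Balaban1983RegularityDecay, p. 582 Lemma 2.4 (2.35), (2.37); typed leaf `B4.Lemma24Printed`] -/
def Bounds235and237 {I : Type} (fam : I → B4.ScaleSetting) (c₀ δ₀ : ℝ) : Prop :=
  ∀ i : I, (fam i).rectLarge →
    (∀ (x : (fam i).SiteF) (y : (fam i).SiteU),
        (fam i).kerGQ x y ≤ c₀ * Real.exp (-(δ₀ * (fam i).distF x y))) ∧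
    (∀ (μ : (fam i).Dir) (x : (fam i).SiteF) (y : (fam i).SiteU),
        (fam i).kerDGQ μ x y ≤ c₀ * Real.exp (-(δ₀ * (fam i).distF x y))) ∧
    (∀ y y' : (fam i).SiteU, (fam i).kerC y y' ≤ c₀ * Real.exp (-(δ₀ * (fam i).distU y y')))

/-- the second half of `B4.Lemma24Printed` at rate `δ₀` and ONE exponent `α`: (2.36) («for α<1, there exists a
constant c₁»). [cite: Balaban1983RegularityDecay, p. 582 Lemma 2.4 (2.36); typed leaf `B4.Lemma24Printed`] -/
def Bound236 {I : Type} (fam : I → B4.ScaleSetting) (δ₀ α : ℝ) : Prop :=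
  ∃ c₁ : ℝ, 0 < c₁ ∧ ∀ i : I, (fam i).rectLarge →
    ∀ (μ : (fam i).Dir) (x x' : (fam i).SiteF) (y : (fam i).SiteU),
      (fam i).lhs236 α μ x x' y ≤ c₁ * Real.exp (-(δ₀ * (fam i).dist2F x x' y))

/-- `B4.Lemma24Printed` is literally: one pair `c₀, δ₀ > 0` with the first half, and the second half at the SAME `δ₀`
for every real `α < 1` (proof `Iff.rfl`). [cite: Balaban1983RegularityDecay, p. 582 Lemma 2.4; typed leaf
`B4.Lemma24Printed`] -/
theorem lemma24Printed_iff {I : Type} (fam : I → B4.ScaleSetting) :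
    B4.Lemma24Printed fam ↔
      ∃ c₀ δ₀ : ℝ, 0 < c₀ ∧ 0 < δ₀ ∧ Bounds235and237 fam c₀ δ₀ ∧ ∀ α : ℝ, α < 1 → Bound236 fam δ₀ α :=
  Iff.rfl

/-- **THE FIRST HALF OF LEMMA 2.4 — (2.35) BOTH QUANTITIES AND (2.37) — FOR THE ZERO-FIELD BOX CARRIERS, ONE PAIR
`c₀, δ₀`.**  For every dimension `d + 1`, block size `L = ℓ + 1 ≥ 2` and window `a_j ∈ [a₋, a₊]` (`a₋ > 0`),
`m_j² ∈ [0, m²₊]`, `a ∈ [a₂₋, a₂₊]` (`a₂₋ > 0`) there are `c₀, δ₀ > 0` such that for EVERY member of the family (every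
mesh `n ≥ 1` — in particular every `n = L^j` —, every constant in the window, every box built of `L`-blocks):
`|(G_j(□)Q_j^*)(x,y)| ≤ c₀e^{−δ₀|ξx−y|_∞}`, `|(∂^ξ_μG_j(□)Q_j^*)(x,y)| ≤ c₀e^{−δ₀|ξx−y|_∞}`, `|C^{(j)}(□;y,y′)| ≤
c₀e^{−δ₀|y−y′|_∞}`.  Assembled from `B4Green242Bridge.greenBoxQ_decay_235_inv`, `greenBoxQ_deriv_decay_235_inv`
(bounds in the block label `|blk x − y|_∞ ≥ |ξx − y|_∞ − 1`, §1) and `B4BoxCov237.cov237_box_decay`, with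
`δ₀ = min(κ_(2.35a), κ_(2.35b), δ_(2.37))`, `c₀ = max(C_(2.35a)e^{κ}, C_(2.35b)e^{κ′}, c_(2.37))`.  This is exactly the
package `H24` consumed by `B5Ineq110Gp.leafGp_of_lemma24` (which uses the first conjunct of `B4.Lemma24Printed` only).
[cite: Balaban1983RegularityDecay, p. 582 Lemma 2.4 (2.35), (2.37) («There exist positive constants c₀, δ₀ … such
that |(G_j(□)Q_j^*)(x, y)|, |(∂_μ^{L^{−j}} G_j(□)Q_j^*)(x, y)| ≤ c₀e^{−δ₀|x−y|} … |C^{(j)}(□; y, y′)| ≤ c₀e^{−δ₀|y−y′|}»),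
p. 584 (proof: (2.37) ⊂ Proposition 2.3; (2.35) via (2.42), (2.44))] -/
theorem bounds235and237_zeroFieldScales (d ℓ : ℕ) (hℓ : 1 ≤ ℓ) {aminus aplus m2plus a2minus a2plus : ℝ}
    (ha : 0 < aminus) (ha2 : 0 < a2minus) :
    ∃ c₀ δ₀ : ℝ, 0 < c₀ ∧ 0 < δ₀ ∧
      Bounds235and237 (zeroFieldScales d ℓ aminus aplus m2plus a2minus a2plus) c₀ δ₀ := by
  obtain ⟨κ₁, C₁, hκ₁, hC₁, H1⟩ := greenBoxQ_decay_235_inv d aminus aplus m2plus ha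
  obtain ⟨κ₂, C₂, hκ₂, hC₂, H2⟩ := greenBoxQ_deriv_decay_235_inv d aminus aplus m2plus ha
  obtain ⟨δ₃, c₃, hδ₃, hc₃, H3⟩ := cov237_box_decay d ℓ hℓ aminus aplus m2plus a2minus a2plus ha ha2
  refine ⟨max (C₁ * Real.exp κ₁) (max (C₂ * Real.exp κ₂) c₃), min κ₁ (min κ₂ δ₃),
    lt_max_of_lt_right (lt_max_of_lt_right hc₃), lt_min hκ₁ (lt_min hκ₂ hδ₃), ?_⟩
  intro i _
  obtain ⟨-, h1⟩ := H1 i.n i.hn i.a₁ i.m2 i.ha₁ i.ha₁' i.hm i.hm' i.M i.one_le_M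
  obtain ⟨-, h2⟩ := H2 i.n i.hn i.a₁ i.m2 i.ha₁ i.ha₁' i.hm i.hm' i.M i.one_le_M
  obtain ⟨-, h3⟩ := H3 i.n i.hn i.a₁ i.m2 i.a₂ i.ha₁ i.ha₁' i.hm i.hm' i.ha₂ i.ha₂' i.M' i.hM
  refine ⟨?_, ?_, ?_⟩
  · intro x y
    have hb := h1 x y.1 y.2
    refine hb.trans ((exp_transport hC₁ hκ₁.le (fdist_le_blk i.hn x.1 y.1)).trans ?_)
    exact exp_bound_weaken (fdist_nonneg _ _ _) (by positivity) (le_max_left _ _) (min_le_left _ _)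
  · intro μ x y
    change Fin (d + 1) at μ
    by_cases h : x.1 + Pi.single μ 1 ∈ boxDom (fun j => i.n * i.M j)
    · have hb := h2 μ x ⟨x.1 + Pi.single μ 1, h⟩ rfl y.1 y.2
      have e : (zeroFieldScales d ℓ aminus aplus m2plus a2minus a2plus i).kerDGQ μ x y =
          ‖(i.n : ℂ) * ∑ x' : ↥(boxDom (fun j => i.n * i.M j)),
            (if blk i.n x'.1 = y.1 then
              (boxOp i.n i.a₁ i.m2 i.M)⁻¹ ⟨x.1 + Pi.single μ 1, h⟩ x' - (boxOp i.n i.a₁ i.m2 i.M)⁻¹ x x' else 0)‖ :=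
        dif_pos h
      rw [e]
      refine hb.trans ((exp_transport hC₂ hκ₂.le (fdist_le_blk i.hn x.1 y.1)).trans ?_)
      exact exp_bound_weaken (fdist_nonneg _ _ _) (by positivity) ((le_max_left _ _).trans (le_max_right _ _))
        ((min_le_right _ _).trans (min_le_left _ _))
    · have e : (zeroFieldScales d ℓ aminus aplus m2plus a2minus a2plus i).kerDGQ μ x y = 0 := dif_neg h
      rw [e]
      positivity
  · intro y y'
    exact (h3 y y').trans (exp_bound_weaken (supNorm_nonneg _) hc₃.le
      ((le_max_right _ _).trans (le_max_right _ _)) ((min_le_right _ _).trans (min_le_right _ _)))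

/-! ## §4  The Hölder clause (2.36) for `0 ≤ α < 1` with ONE rate for all `α` (the print's quantifier order)

The rate in b04's `B4StripSumsHolder.holder248_stripRegular` is `min κ₁ (rOf (d+1))` with `κ₁` from
`B4StripCauchy.uniformStrip_holds` — independent of `α`; only the constant `boundGH d α c m²₊` depends on `α` («the
constant depends on α<1», p. 586).  The tree statements `hkernel248_decay`, `K_holder_decay`,
`greenBoxQ_holder_decay_236(_inv)` quantify the rate AFTER `α`; here the same proofs are re-threaded with the rate
chosen BEFORE `α` (proof texts: b04's, the three kernel packages of `greenBoxQ_holder_decay_236` turned into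
hypotheses), which is what the typed leaf's «∃ c₀ δ₀ … ∀ α < 1, ∃ c₁» requires. -/

section Holder

open Complex MeasureTheory
open Literature.MathematicalPhysics.QuantumFieldTheory.Balaban1983to89.B4Strip
open Literature.MathematicalPhysics.QuantumFieldTheory.Balaban1983to89.B4StripCauchy
open Literature.MathematicalPhysics.QuantumFieldTheory.Balaban1983to89.B4StripSums
open Literature.MathematicalPhysics.QuantumFieldTheory.Balaban1983to89.B4StripSumsHolder
open Literature.MathematicalPhysics.QuantumFieldTheory.Balaban1983to89.B5Strip145Analytic
open scoped Real

/-- `B4StripSumsHolder.hkernel248_decay` with the rate chosen before `α`: ONE `κ > 0` (b04's `min κ₁ (rOf (d+1))`)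
such that for every `0 ≤ α < 1` there is `M ≥ 0` with `‖latticeKernel (GH α n a m2 τ μ σ) x‖ ≤ M e^{−κ|x|_∞}` uniformly
in `n`, the window, `τ`, `μ`, `0 < |σ|_∞ ≤ n`.  Proof text: b04's `holder248_stripRegular` followed by
`B4ContourShift.latticeKernel_decay`. [cite: Balaban1983RegularityDecay, Lemma 2.4 (2.36) p.582 with (2.49)–(2.51)
pp.585–586; proof supplied by the audit along the printed method] -/
theorem hkernel248_decay_unif (d : ℕ) (aminus aplus m2plus : ℝ) (ha : 0 < aminus) :
    ∃ κ : ℝ, 0 < κ ∧ ∀ {α : ℝ}, 0 ≤ α → α < 1 → ∃ M : ℝ, 0 ≤ M ∧ ∀ (n : ℕ) [NeZero n] (a m2 : ℝ), aminus ≤ a →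
      a ≤ aplus → 0 ≤ m2 → m2 ≤ m2plus → ∀ (τ : Fin (d + 1) → Fin n) (μ : Fin (d + 1)) (σ : Fin (d + 1) → ℤ),
        σ ≠ 0 → (∀ ν, |σ ν| ≤ n) → ∀ x : Fin (d + 1) → ℤ,
          ‖latticeKernel (GH α n a m2 τ μ σ) x‖ ≤ M * Real.exp (-(κ * supNorm x)) := by
  obtain ⟨κ₁, c, hκ₁, hc, h⟩ := uniformStrip_holds (d + 1) aminus aplus m2plus ha
  refine ⟨min κ₁ (rOf (d + 1)), lt_min hκ₁ (rOf_pos _), fun {α} hα0 hα1 =>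
    ⟨boundGH d α c (max m2plus 0), boundGH_nonneg _ α hc (le_max_right _ _), ?_⟩⟩
  intro n _ a m2 ha1 ha2 hm hmp τ μ σ hσ0 hσn x
  have hκ0 : 0 ≤ min κ₁ (rOf (d + 1)) := (lt_min hκ₁ (rOf_pos _)).le
  have hsub : Strip (d + 1) (min κ₁ (rOf (d + 1))) ⊆ Strip (d + 1) κ₁ := strip_mono (min_le_left _ _)
  exact latticeKernel_decay (stripRegular_GH n a m2 (max m2plus 0) hm (hmp.trans (le_max_left _ _)) τ μ hσ0 hσn
    hα0 hα1 hκ0 (min_le_right _ _) hc (fun p hp => h n a m2 ha1 ha2 hm hmp p (hsub hp))) hκ0 x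

/-- `B4Green242Bridge.K_holder_decay` with the rate chosen before `α` (proof text b04's, fed by
`hkernel248_decay_unif`). [cite: Balaban1983RegularityDecay, Lemma 2.4 (2.36) p.582, pp.585–586 (2.49)–(2.51); proof
supplied by the audit along the printed method] -/
theorem K_holder_decay_unif (d : ℕ) (aminus aplus m2plus : ℝ) (ha : 0 < aminus) :
    ∃ κ : ℝ, 0 < κ ∧ ∀ {α : ℝ}, 0 ≤ α → α < 1 → ∃ M : ℝ, 0 ≤ M ∧ ∀ (n : ℕ) [NeZero n] (a m2 : ℝ), aminus ≤ a →
      a ≤ aplus → 0 ≤ m2 →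
      m2 ≤ m2plus → ∀ (μ : Fin (d + 1)) (σ : Fin (d + 1) → ℤ), σ ≠ 0 → (∀ ν, |σ ν| ≤ n) →
      ∀ (z y : Fin (d + 1) → ℤ),
        ‖((((n : ℝ) / supNorm σ) ^ α : ℝ) : ℂ) * ((n : ℂ) *
            ((B4Green244.K n a m2 (z + σ + Pi.single μ 1) y - B4Green244.K n a m2 (z + σ) y)
              - (B4Green244.K n a m2 (z + Pi.single μ 1) y - B4Green244.K n a m2 z y)))‖
            ≤ M * Real.exp (-(κ * supNorm (B4Green244.coarse n z - y))) ∧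
        ‖((((n : ℝ) / supNorm σ) ^ α : ℝ) : ℂ) * ((n : ℂ) *
            ((B4Green244.K n a m2 (z + σ + Pi.single μ (-1)) y - B4Green244.K n a m2 (z + σ) y)
              - (B4Green244.K n a m2 (z + Pi.single μ (-1)) y - B4Green244.K n a m2 z y)))‖
            ≤ M * Real.exp (-(κ * supNorm (B4Green244.coarse n z - y))) := by
  obtain ⟨κ, hκ, hU⟩ := hkernel248_decay_unif d aminus aplus m2plus ha
  refine ⟨κ, hκ, fun {α} hα0 hα1 => ?_⟩
  obtain ⟨M, hM, h⟩ := hU hα0 hα1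
  refine ⟨M * Real.exp κ, by positivity, ?_⟩
  intro n _ a m2 h1 h2 h3 h4 μ σ hσ0 hσn z y
  have hn : 1 ≤ n := Nat.one_le_iff_ne_zero.2 (NeZero.ne n)
  have ha' : 0 < a := lt_of_lt_of_le ha h1
  have fwd : ∀ w : Fin (d + 1) → ℤ,
      ‖((((n : ℝ) / supNorm σ) ^ α : ℝ) : ℂ) * ((n : ℂ) *
          ((B4Green244.K n a m2 (w + σ + B4Green244.e μ) y - B4Green244.K n a m2 (w + σ) y)
            - (B4Green244.K n a m2 (w + B4Green244.e μ) y - B4Green244.K n a m2 w y)))‖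
        ≤ M * Real.exp (-(κ * supNorm (B4Green244.coarse n w - y))) := by
    intro w
    rw [K_holder_dd n hn a m2 ha' h3 α w σ y μ]
    exact h n a m2 h1 h2 h3 h4 _ μ σ hσ0 hσn _
  have hM1 : M ≤ M * Real.exp κ := le_mul_of_one_le_right hM (Real.one_le_exp hκ.le)
  constructor
  · exact (fwd z).trans (mul_le_mul_of_nonneg_right hM1 (Real.exp_pos _).le)
  · obtain ⟨w, rfl⟩ : ∃ w, z = w + B4Green244.e μ := ⟨z - B4Green244.e μ, (sub_add_cancel _ _).symm⟩
    have hw : w + B4Green244.e μ + Pi.single μ (-1) = w := by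
      rw [add_assoc, B4Green244.e, ← Pi.single_add, add_neg_cancel, Pi.single_zero, add_zero]
    have hw' : w + B4Green244.e μ + σ + Pi.single μ (-1) = w + σ := by
      rw [add_right_comm w, add_assoc (w + σ), B4Green244.e, ← Pi.single_add, add_neg_cancel, Pi.single_zero,
        add_zero]
    rw [hw', hw, add_right_comm w (B4Green244.e μ) σ]
    have e1 : ((((n : ℝ) / supNorm σ) ^ α : ℝ) : ℂ) * ((n : ℂ) *
          ((B4Green244.K n a m2 (w + σ) y - B4Green244.K n a m2 (w + σ + B4Green244.e μ) y)
            - (B4Green244.K n a m2 w y - B4Green244.K n a m2 (w + B4Green244.e μ) y)))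
        = -(((((n : ℝ) / supNorm σ) ^ α : ℝ) : ℂ) * ((n : ℂ) *
          ((B4Green244.K n a m2 (w + σ + B4Green244.e μ) y - B4Green244.K n a m2 (w + σ) y)
            - (B4Green244.K n a m2 (w + B4Green244.e μ) y - B4Green244.K n a m2 w y)))) := by ring
    rw [e1, norm_neg]
    refine (fwd w).trans ?_
    have hs : supNorm (B4Green244.coarse n (w + B4Green244.e μ) - y) ≤ supNorm (B4Green244.coarse n w - y) + 1 := by
      have h' := supNorm_add_le (B4Green244.coarse n w - y)
        (B4Green244.coarse n (w + B4Green244.e μ) - B4Green244.coarse n w)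
      rw [show B4Green244.coarse n w - y + (B4Green244.coarse n (w + B4Green244.e μ) - B4Green244.coarse n w)
          = B4Green244.coarse n (w + B4Green244.e μ) - y by abel] at h'
      linarith [supNorm_coarse_add_e_sub_le n hn w μ]
    rw [mul_assoc, ← Real.exp_add]
    refine mul_le_mul_of_nonneg_left (Real.exp_le_exp.2 ?_) hM
    have := mul_le_mul_of_nonneg_left hs hκ.le
    linarith

/-- `B4Green242Bridge.greenBoxQ_holder_decay_236` with its three kernel packages as HYPOTHESES (rate `κ₁` of
`K_decay`, `κ₂` of the Hölder kernel bound, `κ₃` of `greenBoxQ_deriv_decay_235`, and any `0 < κ₀ ≤ min κ₁ κ₂`), so that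
the rate of the conclusion, `min (κ₀/(d+1)) κ₃`, is an explicit function of the input rates.  Proof text: b04's,
verbatim after its three `obtain`s. [cite: Balaban1983RegularityDecay, p. 582 Lemma 2.4 (2.36), p. 584 (2.42),
pp. 585–586 (2.49)–(2.51); proof supplied by the audit along the printed method] -/
theorem holder236_param (d : ℕ) {aminus aplus m2plus : ℝ} (ha : 0 < aminus) {α : ℝ} (hα0 : 0 ≤ α)
    {κ₁ MK κ₂ MHc κ₃ C₃ κ₀ : ℝ} (hMK : 0 ≤ MK) (hMHc : 0 ≤ MHc) (hκ₃ : 0 < κ₃) (hC₃ : 0 ≤ C₃)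
    (hκ₀1 : κ₀ ≤ κ₁) (hκ₀2 : κ₀ ≤ κ₂) (hκ₀ : 0 < κ₀)
    (hdec : ∀ (n : ℕ) [NeZero n] (a m2 : ℝ), aminus ≤ a → a ≤ aplus → 0 ≤ m2 → m2 ≤ m2plus →
      ∀ z y : Fin (d + 1) → ℤ,
        ‖B4Green244.K n a m2 z y‖ ≤ MK * Real.exp (-(κ₁ * supNorm (B4Green244.coarse n z - y))))
    (hhol : ∀ (n : ℕ) [NeZero n] (a m2 : ℝ), aminus ≤ a → a ≤ aplus → 0 ≤ m2 →
      m2 ≤ m2plus → ∀ (μ : Fin (d + 1)) (σ : Fin (d + 1) → ℤ), σ ≠ 0 → (∀ ν, |σ ν| ≤ n) →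
      ∀ (z y : Fin (d + 1) → ℤ),
        ‖((((n : ℝ) / supNorm σ) ^ α : ℝ) : ℂ) * ((n : ℂ) *
            ((B4Green244.K n a m2 (z + σ + Pi.single μ 1) y - B4Green244.K n a m2 (z + σ) y)
              - (B4Green244.K n a m2 (z + Pi.single μ 1) y - B4Green244.K n a m2 z y)))‖
            ≤ MHc * Real.exp (-(κ₂ * supNorm (B4Green244.coarse n z - y))) ∧
        ‖((((n : ℝ) / supNorm σ) ^ α : ℝ) : ℂ) * ((n : ℂ) *
            ((B4Green244.K n a m2 (z + σ + Pi.single μ (-1)) y - B4Green244.K n a m2 (z + σ) y)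
              - (B4Green244.K n a m2 (z + Pi.single μ (-1)) y - B4Green244.K n a m2 z y)))‖
            ≤ MHc * Real.exp (-(κ₂ * supNorm (B4Green244.coarse n z - y))))
    (hfar : ∀ (n : ℕ), 1 ≤ n → ∀ (a m2 : ℝ), aminus ≤ a → a ≤ aplus → 0 ≤ m2 → m2 ≤ m2plus →
      ∀ (M : Fin (d + 1) → ℕ), (∀ i, 1 ≤ M i) →
      ∀ (GB : Matrix ↥(boxDom (fun i => n * M i)) ↥(boxDom (fun i => n * M i)) ℂ),
        (Matrix.of fun x y : ↥(boxDom (fun i => n * M i)) =>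
            opBoxK ((n : ℂ) ^ 2) (m2 : ℂ) ((a : ℂ) * ((n : ℂ) ^ (d + 1))⁻¹) n (fun i => n * M i) x.1 y.1) * GB = 1 →
        ∀ (μ : Fin (d + 1)) (x xe : ↥(boxDom (fun i => n * M i))), xe.1 = x.1 + Pi.single μ 1 →
        ∀ (y : Fin (d + 1) → ℤ), y ∈ boxDom M →
          ‖(n : ℂ) * ∑ x' : ↥(boxDom (fun i => n * M i)), (if blk n x'.1 = y then GB xe x' - GB x x' else 0)‖
            ≤ C₃ * Real.exp (-(κ₃ * supNorm (blk n x.1 - y)))) :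
    ∀ (n : ℕ), 1 ≤ n → ∀ (a m2 : ℝ), aminus ≤ a → a ≤ aplus → 0 ≤ m2 → m2 ≤ m2plus →
      ∀ (M : Fin (d + 1) → ℕ), (∀ i, 1 ≤ M i) →
      ∀ (GB : Matrix ↥(boxDom (fun i => n * M i)) ↥(boxDom (fun i => n * M i)) ℂ),
        (Matrix.of fun x y : ↥(boxDom (fun i => n * M i)) =>
            opBoxK ((n : ℂ) ^ 2) (m2 : ℂ) ((a : ℂ) * ((n : ℂ) ^ (d + 1))⁻¹) n (fun i => n * M i) x.1 y.1) * GB = 1 →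
        ∀ (μ : Fin (d + 1)) (x xe x' xe' : ↥(boxDom (fun i => n * M i))), xe.1 = x.1 + Pi.single μ 1 →
          xe'.1 = x'.1 + Pi.single μ 1 → x'.1 ≠ x.1 →
        ∀ (y : Fin (d + 1) → ℤ), y ∈ boxDom M →
          ((n : ℝ) / supNorm (x'.1 - x.1)) ^ α *
              ‖(n : ℂ) * ∑ x'' : ↥(boxDom (fun i => n * M i)),
                (if blk n x''.1 = y then (GB xe' x'' - GB x' x'') - (GB xe x'' - GB x x'') else 0)‖
            ≤ C236 d κ₀ MHc C₃ * Real.exp (-(min (κ₀ / (d + 1)) κ₃ * min (supNorm (blk n x.1 - y)) (supNorm (blk n x'.1 - y)))) := by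
  have hC0 : 0 ≤ C235 d κ₀ MHc := C235_nonneg d hκ₀ hMHc
  intro n hn a m2 h1 h2 h3 h4 M hM GB hGB μ x xe x' xe' hxe hxe' hne y hy
  haveI : NeZero n := ⟨by omega⟩
  have ha' : 0 < a := lt_of_lt_of_le ha h1
  have hN : ∀ i, 1 ≤ (fun i => n * M i) i := fun i => Nat.one_le_iff_ne_zero.2 (Nat.mul_ne_zero_iff.2
    ⟨by omega, Nat.one_le_iff_ne_zero.1 (hM i)⟩)
  have hn0 : (0 : ℝ) < n := by exact_mod_cast hn
  -- the displacement `v = x′ − x ≠ 0`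
  obtain ⟨v, hv⟩ : ∃ v : Fin (d + 1) → ℤ, x'.1 = x.1 + v := ⟨x'.1 - x.1, (add_sub_cancel _ _).symm⟩
  have hvx : x'.1 - x.1 = v := by rw [hv, add_sub_cancel_left]
  have hv0 : v ≠ 0 := fun h0 => hne (by rw [hv, h0, add_zero])
  have hsn : 0 < supNorm v := lt_of_lt_of_le one_pos (one_le_supNorm hv0)
  rw [hvx]
  set c : ℝ := ((n : ℝ) / supNorm v) ^ α with hc
  have hc0 : 0 ≤ c := Real.rpow_nonneg (div_nonneg hn0.le hsn.le) α
  -- comparison of the exponential factors with the common one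
  have hexp : ∀ {k k' t t' : ℝ}, k ≤ k' → t ≤ t' → 0 ≤ t → 0 ≤ k' →
      Real.exp (-(k' * t')) ≤ Real.exp (-(k * t)) :=
    fun hk ht ht0 hk' => Real.exp_le_exp.2 (neg_le_neg (mul_le_mul hk ht ht0 hk'))
  have hm0 : 0 ≤ min (supNorm (blk n x.1 - y)) (supNorm (blk n x'.1 - y)) :=
    le_min (supNorm_nonneg _) (supNorm_nonneg _)
  have hE1 : Real.exp (-(κ₀ / (d + 1) * supNorm (blk n x.1 - y)))
      ≤ Real.exp (-(min (κ₀ / (d + 1)) κ₃ * min (supNorm (blk n x.1 - y)) (supNorm (blk n x'.1 - y)))) :=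
    hexp (min_le_left _ _) (min_le_left _ _) hm0 (by positivity)
  have hE2 : Real.exp (-(κ₃ * supNorm (blk n x.1 - y)))
      ≤ Real.exp (-(min (κ₀ / (d + 1)) κ₃ * min (supNorm (blk n x.1 - y)) (supNorm (blk n x'.1 - y)))) :=
    hexp (min_le_right _ _) (min_le_left _ _) hm0 hκ₃.le
  have hE3 : Real.exp (-(κ₃ * supNorm (blk n x'.1 - y)))
      ≤ Real.exp (-(min (κ₀ / (d + 1)) κ₃ * min (supNorm (blk n x.1 - y)) (supNorm (blk n x'.1 - y)))) :=
    hexp (min_le_right _ _) (min_le_right _ _) hm0 hκ₃.le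
  set Ecom := Real.exp (-(min (κ₀ / (d + 1)) κ₃ * min (supNorm (blk n x.1 - y)) (supNorm (blk n x'.1 - y))))
    with hEcom
  have hEcom0 : 0 ≤ Ecom := (Real.exp_pos _).le
  by_cases hnear : ∀ ν, |v ν| ≤ n
  · -- NEAR PAIRS: the Hölder kernel bound through the images
    have hcpos : 0 < c := Real.rpow_pos_of_pos (div_pos hn0 hsn) α
    have hweak : ∀ {κ : ℝ}, κ₀ ≤ κ → ∀ s : ℝ, 0 ≤ s → Real.exp (-(κ * s)) ≤ Real.exp (-(κ₀ * s)) :=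
      fun hk s hs => Real.exp_le_exp.2 (neg_le_neg (mul_le_mul_of_nonneg_right hk hs))
    have hKdec : ∀ u w : Fin (d + 1) → ℤ, ‖B4Green244.K n a m2 u w‖
        ≤ MK * Real.exp (-(κ₀ * supNorm (blk n u - w))) :=
      fun u w => (hdec n a m2 h1 h2 h3 h4 u w).trans
        (mul_le_mul_of_nonneg_left (hweak hκ₀1 _ (supNorm_nonneg _)) hMK)
    have hKhol : ∀ (ε : Fin (d + 1) → Bool) (u w : Fin (d + 1) → ℤ),
        ‖(B4Green244.K n a m2 (u + sflip ε v + Pi.single μ 1) w - B4Green244.K n a m2 (u + sflip ε v) w)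
            - (B4Green244.K n a m2 (u + Pi.single μ 1) w - B4Green244.K n a m2 u w)‖
            ≤ MHc / (c * n) * Real.exp (-(κ₀ * supNorm (blk n u - w))) ∧
        ‖(B4Green244.K n a m2 (u + sflip ε v + Pi.single μ (-1)) w - B4Green244.K n a m2 (u + sflip ε v) w)
            - (B4Green244.K n a m2 (u + Pi.single μ (-1)) w - B4Green244.K n a m2 u w)‖
            ≤ MHc / (c * n) * Real.exp (-(κ₀ * supNorm (blk n u - w))) := by
      intro ε u w
      obtain ⟨hf, hb⟩ := hhol n a m2 h1 h2 h3 h4 μ (sflip ε v) (sflip_ne_zero ε hv0)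
        (fun ν => by rw [abs_sflip_apply]; exact hnear ν) u w
      rw [supNorm_sflip, ← hc] at hf hb
      have conv : ∀ {D : ℂ}, ‖((c : ℝ) : ℂ) * ((n : ℂ) * D)‖ ≤ MHc * Real.exp (-(κ₂ * supNorm (blk n u - w))) →
          ‖D‖ ≤ MHc / (c * n) * Real.exp (-(κ₀ * supNorm (blk n u - w))) := by
        intro D hD
        rw [norm_mul, norm_mul, Complex.norm_real, Complex.norm_natCast, Real.norm_eq_abs, abs_of_nonneg hc0] at hD
        have hD' : c * (n * ‖D‖) ≤ MHc * Real.exp (-(κ₀ * supNorm (blk n u - w))) :=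
          hD.trans (mul_le_mul_of_nonneg_left (hweak hκ₀2 _ (supNorm_nonneg _)) hMHc)
        rw [div_mul_eq_mul_div, le_div_iff₀ (mul_pos hcpos hn0)]
        linarith
      exact ⟨conv hf, conv hb⟩
    have h := greenBoxQ_holder_src hn hM hN ((n : ℂ) ^ 2) (m2 : ℂ) ((a : ℂ) * ((n : ℂ) ^ (d + 1))⁻¹) hκ₀ hMK
      (div_nonneg hMHc (mul_pos hcpos hn0).le) (fun u w => green244_kernelForm n hn a m2 ha' h3 u w) hKdec μ v hKhol
      GB hGB x xe x' xe' hxe hv hxe' hy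
    rw [norm_mul, Complex.norm_natCast]
    have h' := mul_le_mul_of_nonneg_left h (mul_pos hcpos hn0).le
    rw [show c * n * (MHc / (c * n) * boxConst κ₀ d M * Real.exp (-(κ₀ / (d + 1) * supNorm (blk n x.1 - y))))
        = MHc * boxConst κ₀ d M * Real.exp (-(κ₀ / (d + 1) * supNorm (blk n x.1 - y))) by
          field_simp] at h'
    calc c * (n * ‖∑ x'' : ↥(boxDom (fun i => n * M i)),
            (if blk n x''.1 = y then (GB xe' x'' - GB x' x'') - (GB xe x'' - GB x x'') else 0)‖)
        = c * n * ‖∑ x'' : ↥(boxDom (fun i => n * M i)),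
            (if blk n x''.1 = y then (GB xe' x'' - GB x' x'') - (GB xe x'' - GB x x'') else 0)‖ := by ring
      _ ≤ MHc * boxConst κ₀ d M * Real.exp (-(κ₀ / (d + 1) * supNorm (blk n x.1 - y))) := h'
      _ ≤ C235 d κ₀ MHc * Real.exp (-(κ₀ / (d + 1) * supNorm (blk n x.1 - y))) := by
          unfold C235
          exact mul_le_mul_of_nonneg_right (mul_le_mul_of_nonneg_left (boxConst_le_one hκ₀ hM) hMHc)
            (Real.exp_pos _).le
      _ ≤ C235 d κ₀ MHc * Ecom := mul_le_mul_of_nonneg_left hE1 hC0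
      _ ≤ C236 d κ₀ MHc C₃ * Ecom := by
          unfold C236
          exact mul_le_mul_of_nonneg_right (le_add_of_nonneg_right (by positivity)) hEcom0
  · -- FAR PAIRS: the weight is `≤ 1`; the two first differences separately by (2.35), second quantity
    obtain ⟨ν, hν⟩ := not_forall.1 hnear
    have hν' : (n : ℤ) < |v ν| := not_le.1 hν
    have hsup : (n : ℝ) ≤ supNorm v := by
      have h1' : ((n : ℤ) : ℝ) ≤ ((|v ν| : ℤ) : ℝ) := Int.cast_le.2 hν'.le
      rw [Int.cast_natCast] at h1'
      exact h1'.trans (abs_le_supNorm v ν)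
    have hc1 : c ≤ 1 := Real.rpow_le_one (div_nonneg hn0.le hsn.le) (div_le_one_of_le₀ hsup hsn.le) hα0
    have hsplit : ∑ x'' : ↥(boxDom (fun i => n * M i)),
          (if blk n x''.1 = y then (GB xe' x'' - GB x' x'') - (GB xe x'' - GB x x'') else 0)
        = ∑ x'' : ↥(boxDom (fun i => n * M i)), (if blk n x''.1 = y then GB xe' x'' - GB x' x'' else 0)
          - ∑ x'' : ↥(boxDom (fun i => n * M i)), (if blk n x''.1 = y then GB xe x'' - GB x x'' else 0) := by
      rw [← Finset.sum_sub_distrib]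
      refine Finset.sum_congr rfl fun x'' _ => ?_
      split_ifs <;> simp
    have hA := hfar n hn a m2 h1 h2 h3 h4 M hM GB hGB μ x' xe' hxe' y hy
    have hB := hfar n hn a m2 h1 h2 h3 h4 M hM GB hGB μ x xe hxe y hy
    rw [hsplit, mul_sub]
    calc c * ‖(n : ℂ) * ∑ x'' : ↥(boxDom (fun i => n * M i)), (if blk n x''.1 = y then GB xe' x'' - GB x' x'' else 0)
            - (n : ℂ) * ∑ x'' : ↥(boxDom (fun i => n * M i)), (if blk n x''.1 = y then GB xe x'' - GB x x'' else 0)‖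
        ≤ 1 * ‖(n : ℂ) * ∑ x'' : ↥(boxDom (fun i => n * M i)), (if blk n x''.1 = y then GB xe' x'' - GB x' x'' else 0)
            - (n : ℂ) * ∑ x'' : ↥(boxDom (fun i => n * M i)), (if blk n x''.1 = y then GB xe x'' - GB x x'' else 0)‖ :=
          mul_le_mul_of_nonneg_right hc1 (norm_nonneg _)
      _ ≤ ‖(n : ℂ) * ∑ x'' : ↥(boxDom (fun i => n * M i)), (if blk n x''.1 = y then GB xe' x'' - GB x' x'' else 0)‖
            + ‖(n : ℂ) * ∑ x'' : ↥(boxDom (fun i => n * M i)), (if blk n x''.1 = y then GB xe x'' - GB x x'' else 0)‖ := by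
          rw [one_mul]; exact norm_sub_le _ _
      _ ≤ C₃ * Real.exp (-(κ₃ * supNorm (blk n x'.1 - y))) + C₃ * Real.exp (-(κ₃ * supNorm (blk n x.1 - y))) :=
          add_le_add hA hB
      _ ≤ C₃ * Ecom + C₃ * Ecom := add_le_add (mul_le_mul_of_nonneg_left hE3 hC₃) (mul_le_mul_of_nonneg_left hE2 hC₃)
      _ = 2 * C₃ * Ecom := by ring
      _ ≤ C236 d κ₀ MHc C₃ * Ecom := by
          unfold C236
          exact mul_le_mul_of_nonneg_right (le_add_of_nonneg_left hC0) hEcom0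

end Holder

/-! ## §5  (2.36) for the zero-field box carriers with one rate for all `0 ≤ α < 1`; the leaf with `0 ≤ α` -/

/-- **(2.36) FOR THE ZERO-FIELD BOX CARRIERS, ONE RATE `δ₁` FOR ALL `0 ≤ α < 1`, A CONSTANT `c₁ = c₁(α)`** — the
print's quantifier order («positive constants c₀, δ₀, and for α<1, there exists a constant c₁»; p. 586 «the constant
depends on α<1»): `(1/|ξx−ξx′|_∞^α)|(∂^ξ_μG_j(□)Q_j^*)(x,y) − (∂^ξ_μG_j(□)Q_j^*)(x′,y)| ≤ c₁e^{−δ₁ dist_∞({ξx,ξx′},y)}`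
for every member of the family.  Assembled from `B4Green244.K_decay`, `K_holder_decay_unif` (§4),
`B4Green242Bridge.greenBoxQ_deriv_decay_235` through `holder236_param` (b04's proof of `greenBoxQ_holder_decay_236`),
and `B4Green242Bridge.boxOp_mul_inv` (the box propagator exists). [cite: Balaban1983RegularityDecay, p. 582 Lemma 2.4
(2.36), p. 584 (2.42)/(2.44), pp. 585–586 (2.49)–(2.51)] -/
theorem bound236_zeroFieldScales (d ℓ : ℕ) {aminus aplus m2plus a2minus a2plus : ℝ} (ha : 0 < aminus) :
    ∃ δ₁ : ℝ, 0 < δ₁ ∧ ∀ α : ℝ, 0 ≤ α → α < 1 →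
      Bound236 (zeroFieldScales d ℓ aminus aplus m2plus a2minus a2plus) δ₁ α := by
  obtain ⟨κ₁, MK, hκ₁, hMK, hdec⟩ := B4Green244.K_decay d aminus aplus m2plus ha
  obtain ⟨κ₂, hκ₂, hU⟩ := K_holder_decay_unif d aminus aplus m2plus ha
  obtain ⟨κ₃, C₃, hκ₃, hC₃, hfar⟩ := greenBoxQ_deriv_decay_235 d aminus aplus m2plus ha
  obtain ⟨κ₀, hκ₀1, hκ₀2, hκ₀⟩ : ∃ κ₀, κ₀ ≤ κ₁ ∧ κ₀ ≤ κ₂ ∧ 0 < κ₀ :=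
    ⟨min κ₁ κ₂, min_le_left _ _, min_le_right _ _, lt_min hκ₁ hκ₂⟩
  have hκpos : 0 < min (κ₀ / (d + 1)) κ₃ := lt_min (by positivity) hκ₃
  refine ⟨min (κ₀ / (d + 1)) κ₃, hκpos, fun α hα0 hα1 => ?_⟩
  obtain ⟨MHc, hMHc, hhol⟩ := hU hα0 hα1
  have H := holder236_param d ha hα0 hMK hMHc hκ₃ hC₃ hκ₀1 hκ₀2 hκ₀ hdec hhol hfar
  have hC : 0 ≤ C236 d κ₀ MHc C₃ := by
    have := C235_nonneg d hκ₀ hMHc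
    unfold C236
    positivity
  refine ⟨C236 d κ₀ MHc C₃ * Real.exp (min (κ₀ / (d + 1)) κ₃) + 1, by positivity, ?_⟩
  intro i _ μ x x' y
  change Fin (d + 1) at μ
  by_cases hg : x.1 + Pi.single μ 1 ∈ boxDom (fun j => i.n * i.M j) ∧
      x'.1 + Pi.single μ 1 ∈ boxDom (fun j => i.n * i.M j) ∧ x'.1 ≠ x.1
  · have hGB := boxOp_mul_inv i.hn (lt_of_lt_of_le ha i.ha₁) i.hm i.one_le_M
    have hb := H i.n i.hn i.a₁ i.m2 i.ha₁ i.ha₁' i.hm i.hm' i.M i.one_le_M _ hGB μ x ⟨_, hg.1⟩ x' ⟨_, hg.2.1⟩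
      rfl rfl hg.2.2 y.1 y.2
    have hmin : min (fdist i.n x.1 y.1) (fdist i.n x'.1 y.1)
        ≤ min (supNorm (blk i.n x.1 - y.1)) (supNorm (blk i.n x'.1 - y.1)) + 1 := by
      rw [← min_add_add_right]
      exact min_le_min (fdist_le_blk i.hn _ _) (fdist_le_blk i.hn _ _)
    simp only [zeroFieldScales, dif_pos hg]
    refine hb.trans ((exp_transport hC hκpos.le hmin).trans ?_)
    exact exp_bound_weaken (le_min (fdist_nonneg _ _ _) (fdist_nonneg _ _ _)) (by positivity) (by linarith) le_rfl
  · simp only [zeroFieldScales, dif_neg hg]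
    positivity

/-- **THE TYPED LEAF WITH THE HÖLDER EXPONENT RESTRICTED TO `0 ≤ α < 1`**: literally `B4.Lemma24Printed` (B4.lean)
with `0 ≤ α →` inserted in its second conjunct; nothing else changed (see HONEST SCOPE (e) for why the typed clause
with `α < 0` is not claimed). [cite: Balaban1983RegularityDecay, p. 582 Lemma 2.4 (2.35)–(2.37); typed leaf
`B4.Lemma24Printed` restricted] -/
def Lemma24PrintedNN {I : Type} (fam : I → B4.ScaleSetting) : Prop :=
  ∃ c₀ δ₀ : ℝ, 0 < c₀ ∧ 0 < δ₀ ∧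
    (∀ i : I, (fam i).rectLarge →
      (∀ (x : (fam i).SiteF) (y : (fam i).SiteU),
          (fam i).kerGQ x y ≤ c₀ * Real.exp (-(δ₀ * (fam i).distF x y))) ∧
      (∀ (μ : (fam i).Dir) (x : (fam i).SiteF) (y : (fam i).SiteU),
          (fam i).kerDGQ μ x y ≤ c₀ * Real.exp (-(δ₀ * (fam i).distF x y))) ∧
      (∀ y y' : (fam i).SiteU, (fam i).kerC y y' ≤ c₀ * Real.exp (-(δ₀ * (fam i).distU y y')))) ∧
    (∀ α : ℝ, 0 ≤ α → α < 1 → ∃ c₁ : ℝ, 0 < c₁ ∧ ∀ i : I, (fam i).rectLarge →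
      ∀ (μ : (fam i).Dir) (x x' : (fam i).SiteF) (y : (fam i).SiteU),
        (fam i).lhs236 α μ x x' y ≤ c₁ * Real.exp (-(δ₀ * (fam i).dist2F x x' y)))

/-- the restricted leaf in terms of the two halves (proof `Iff.rfl`). [cite: Balaban1983RegularityDecay, p. 582
Lemma 2.4] -/
theorem lemma24PrintedNN_iff {I : Type} (fam : I → B4.ScaleSetting) :
    Lemma24PrintedNN fam ↔
      ∃ c₀ δ₀ : ℝ, 0 < c₀ ∧ 0 < δ₀ ∧ Bounds235and237 fam c₀ δ₀ ∧
        ∀ α : ℝ, 0 ≤ α → α < 1 → Bound236 fam δ₀ α :=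
  Iff.rfl

/-- the typed leaf implies the restricted one, for ANY family (drop the instances `α < 0`).
[cite: Balaban1983RegularityDecay, p. 582 Lemma 2.4; typed leaf `B4.Lemma24Printed`] -/
theorem lemma24PrintedNN_of_printed {I : Type} (fam : I → B4.ScaleSetting) :
    B4.Lemma24Printed fam → Lemma24PrintedNN fam := by
  rintro ⟨c₀, δ₀, hc, hδ, h1, h2⟩
  exact ⟨c₀, δ₀, hc, hδ, h1, fun α _ hα => h2 α hα⟩

/-- **LEMMA 2.4 (2.35)–(2.37), AS TYPED WITH `0 ≤ α < 1`, FOR THE ZERO-FIELD BOX CARRIERS — HYPOTHESIS-FREE.**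
For every dimension `d + 1`, block size `L = ℓ + 1 ≥ 2` and window with `a₋ > 0`, `a₂₋ > 0`:
`Lemma24PrintedNN (zeroFieldScales d ℓ a₋ a₊ m²₊ a₂₋ a₂₊)` — ONE pair `c₀, δ₀ > 0` serving (2.35) (both quantities),
(2.37) and, for every `0 ≤ α < 1` with a constant `c₁(α)`, (2.36), uniformly over every mesh `n ≥ 1`, every constant in
the window and every box built of `L`-blocks (`δ₀ = min` of the rates of `bounds235and237_zeroFieldScales` and
`bound236_zeroFieldScales`). [cite: Balaban1983RegularityDecay, p. 582 Lemma 2.4 (2.35)–(2.37), p. 584, pp. 585–586] -/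
theorem lemma24PrintedNN_zeroFieldScales (d ℓ : ℕ) (hℓ : 1 ≤ ℓ) {aminus aplus m2plus a2minus a2plus : ℝ}
    (ha : 0 < aminus) (ha2 : 0 < a2minus) :
    Lemma24PrintedNN (zeroFieldScales d ℓ aminus aplus m2plus a2minus a2plus) := by
  obtain ⟨c₀, δ₀, hc₀, hδ₀, H1⟩ := bounds235and237_zeroFieldScales d ℓ hℓ
    (aplus := aplus) (m2plus := m2plus) (a2plus := a2plus) ha ha2
  obtain ⟨δ₁, hδ₁, H2⟩ := bound236_zeroFieldScales d ℓ (aplus := aplus) (m2plus := m2plus)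
    (a2minus := a2minus) (a2plus := a2plus) ha
  refine ⟨c₀, min δ₀ δ₁, hc₀, lt_min hδ₀ hδ₁, ?_, ?_⟩
  · intro i hi
    obtain ⟨h1, h2, h3⟩ := H1 i hi
    exact ⟨fun x y => (h1 x y).trans (exp_bound_weaken (fdist_nonneg _ _ _) hc₀.le le_rfl (min_le_left _ _)),
      fun μ x y => (h2 μ x y).trans (exp_bound_weaken (fdist_nonneg _ _ _) hc₀.le le_rfl (min_le_left _ _)),
      fun y y' => (h3 y y').trans (exp_bound_weaken (supNorm_nonneg _) hc₀.le le_rfl (min_le_left _ _))⟩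
  · intro α hα0 hα1
    obtain ⟨c₁, hc₁, h⟩ := H2 α hα0 hα1
    exact ⟨c₁, hc₁, fun i hi μ x x' y => (h i hi μ x x' y).trans
      (exp_bound_weaken (le_min (fdist_nonneg _ _ _) (fdist_nonneg _ _ _)) hc₁.le le_rfl (min_le_right _ _))⟩

/-! ## §6  Non-vacuity -/

/-- an instance of the index at `d + 1 = 4`, `L = 2`, window `[1/2, 2] × [0, 1] × [1/2, 2]`: mesh `n = 2` (`j = 1`),
`a_j = 1`, `m_j² = 0`, `a = 1`, the unit box `[0, 2)^4` (one `L`-block). [folklore] -/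
def idx0 : ScaleIdx 3 1 (1 / 2) 2 1 (1 / 2) 2 where
  n := 2
  hn := by norm_num
  a₁ := 1
  m2 := 0
  a₂ := 1
  ha₁ := by norm_num
  ha₁' := by norm_num
  hm := le_rfl
  hm' := by norm_num
  ha₂ := by norm_num
  ha₂' := by norm_num
  M' := fun _ => 1
  hM := fun _ => le_rfl

/-- the index type of the physical window is inhabited. [folklore] -/
instance : Nonempty (ScaleIdx 3 1 (1 / 2) 2 1 (1 / 2) 2) := ⟨idx0⟩

/-- non-vacuity: the restricted leaf holds for the zero-field box family of the physical window `d + 1 = 4`, `L = 2`,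
`a_j ∈ [1/2, 2]`, `m_j² ∈ [0, 1]`, `a ∈ [1/2, 2]`; the index type is inhabited (`idx0`) and the hypothesis `rectLarge`
of every member is `True` (next `example`), so the conclusions are genuinely asserted. [folklore] -/
example : Lemma24PrintedNN (zeroFieldScales 3 1 (1 / 2) 2 1 (1 / 2) 2) :=
  lemma24PrintedNN_zeroFieldScales 3 1 le_rfl (by norm_num) (by norm_num)

/-- the only hypothesis of the typed leaf's clauses, `rectLarge`, holds (it is `True`) for the member `idx0`. [folklore] -/
example : (zeroFieldScales 3 1 (1 / 2) 2 1 (1 / 2) 2 idx0).rectLarge := trivial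

/-- the member `idx0` has a fine site, a unit site and a direction, so the universally quantified conclusions of the
leaf are not over empty types. [folklore] -/
example : Nonempty (zeroFieldScales 3 1 (1 / 2) 2 1 (1 / 2) 2 idx0).SiteF ∧
    Nonempty (zeroFieldScales 3 1 (1 / 2) 2 1 (1 / 2) 2 idx0).SiteU ∧
    Nonempty (zeroFieldScales 3 1 (1 / 2) 2 1 (1 / 2) 2 idx0).Dir :=
  ⟨⟨⟨0, by simp [idx0, ScaleIdx.M, mem_boxDom]⟩⟩,
   ⟨⟨0, by simp [idx0, ScaleIdx.M, mem_boxDom]⟩⟩, ⟨(0 : Fin 4)⟩⟩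

end

end Literature.MathematicalPhysics.QuantumFieldTheory.Balaban1983to89.B4Lemma24ZeroBoxScale
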